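import Mathlib
import Literature.NumberTheory.Transcendental.KZCalculus
import Summits.KontsevichZagierPeriods.KontsevichZagierPeriods.Theorems.TorsionLogsNeronTorsionSectorStubHaarReps
import HarnessLib

/-!
# Crux `TorsionLogs.NeronTorsionSector` (stmt-KontsevichZagierPeriods-14500) — assembly, representation constructors

Helpers for the lead's stub `stub_assembly` (line `registered`): generic constructors of KZ integral
representations from DOMINATION data, used for the reps of the translation chain in the compactifying chart
`s = x^{-1/2}` at infinity (`[(0,s₁)², ĥ(s′)·(2/R s)(2/R s′)]`, the mixed cell `[(x₂,x₁)×(0,s₁), …]`, the third-kind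
reps `[(0,s₁), Q̂·2/R]`, `[(0,s₁), Q̂⁺·2/R]`): a `ℚ`-semialgebraic function on a `ℚ`-semialgebraic set dominated by
`M·φ₀(z 0)·φ₁(z 1)` with `φᵢ` integrable on the coordinate shadows is absolutely integrable
(`integrableOn_of_abs_le_const_mul_prod` with the single dominating function `𝟙_A|φ₀| + 𝟙_B|φ₁|`).
[cite: KontsevichZagier2001, §1.1]
-/

noncomputable section

open Set MeasureTheory
open Literature.NumberTheory.Transcendental Literature.ModelTheory.ExponentialFields

-- `Summit.KontsevichZagierPeriods.KontsevichZagierPeriods.…` is the tree's mandated layout (single-conjunct summit).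
set_option linter.dupNamespace false

namespace Summit.KontsevichZagierPeriods.KontsevichZagierPeriods.Cruxes.NeronTorsionSector.Translation

/-- **Plane representations from domination.** A `ℚ`-semialgebraic `F` on a `ℚ`-semialgebraic `S ⊆ A × B` with
`|F z| ≤ M·φ₀(z 0)·φ₁(z 1)`, `φ₀` integrable on `A`, `φ₁` integrable on `B` (both measurable sets), is the
integrand of a KZ representation with domain `S`. [cite: KontsevichZagier2001, §1.1] -/
theorem asmReps_exists_rep2 : ∀ (S : Set (Fin 2 → ℝ)) (A B : Set ℝ) (F : (Fin 2 → ℝ) → ℝ) (φ₀ φ₁ : ℝ → ℝ) (M : ℝ), IsSemialgebraic ℚ S → S ⊆ {z | z 0 ∈ A ∧ z 1 ∈ B} → MeasurableSet A → MeasurableSet B → IsSemialgebraicFunOn ℚ S F → MeasureTheory.IntegrableOn φ₀ A → MeasureTheory.IntegrableOn φ₁ B → (∀ z ∈ S, |F z| ≤ M * (φ₀ (z 0) * φ₁ (z 1))) → ∃ r : Literature.NumberTheory.Transcendental.KZ.IntegralRep 2, r.domain = S ∧ r.integrand = F := by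
  intro S A B F φ₀ φ₁ M hS hSAB hA hB hF h₀ h₁ hbound
  -- one dominating function for both coordinates
  set φ : ℝ → ℝ := A.indicator (fun t => |φ₀ t|) + B.indicator (fun t => |φ₁ t|) with hφ
  have hφint : Integrable φ := by
    rw [hφ]
    exact ((IntegrableOn.integrable_indicator h₀.abs hA)).add (IntegrableOn.integrable_indicator h₁.abs hB)
  have hφnn : ∀ t, 0 ≤ φ t := fun t => by
    rw [hφ]
    exact add_nonneg (Set.indicator_nonneg (fun _ _ => abs_nonneg _) _)
      (Set.indicator_nonneg (fun _ _ => abs_nonneg _) _)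
  have hφ₀ : ∀ t ∈ A, |φ₀ t| ≤ φ t := fun t ht => by
    rw [hφ, Pi.add_apply, Set.indicator_of_mem ht]
    exact le_add_of_nonneg_right (Set.indicator_nonneg (fun _ _ => abs_nonneg _) _)
  have hφ₁ : ∀ t ∈ B, |φ₁ t| ≤ φ t := fun t ht => by
    rw [hφ, Pi.add_apply, Set.indicator_of_mem ht]
    exact le_add_of_nonneg_left (Set.indicator_nonneg (fun _ _ => abs_nonneg _) _)
  have hmeasS : MeasurableSet S := IsSemialgebraic.measurableSet_holds hS
  have hint : IntegrableOn F S := by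
    refine integrableOn_of_abs_le_const_mul_prod hφint hmeasS
      (measurable_restrict_of_isSemialgebraicFunOn hF) |M| fun z hz => ?_
    obtain ⟨hz0, hz1⟩ := hSAB hz
    rw [Fin.prod_univ_two]
    calc |F z| ≤ M * (φ₀ (z 0) * φ₁ (z 1)) := hbound z hz
      _ ≤ |M * (φ₀ (z 0) * φ₁ (z 1))| := le_abs_self _
      _ = |M| * (|φ₀ (z 0)| * |φ₁ (z 1)|) := by rw [abs_mul, abs_mul]
      _ ≤ |M| * (φ (z 0) * φ (z 1)) := by
          refine mul_le_mul_of_nonneg_left ?_ (abs_nonneg _)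
          exact mul_le_mul (hφ₀ _ hz0) (hφ₁ _ hz1) (abs_nonneg _) (hφnn _)
  exact ⟨⟨S, F, hS, hF, hint⟩, rfl, rfl⟩

/-- **Line representations from a bound.** A bounded `ℚ`-semialgebraic `g` on a `ℚ`-semialgebraic `I ⊆ ℝ` of
finite measure is the integrand of a KZ representation with domain `{t | t 0 ∈ I}`.
[cite: KontsevichZagier2001, §1.1] -/
theorem asmReps_exists_rep1 (I : Set ℝ) (g : ℝ → ℝ) (M : ℝ)
    (hI : IsSemialgebraic ℚ {t : Fin 1 → ℝ | t 0 ∈ I}) (hIm : MeasurableSet I) (hIfin : volume I ≠ ⊤)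
    (hg : IsSemialgebraicFunOn ℚ {t : Fin 1 → ℝ | t 0 ∈ I} (fun t => g (t 0)))
    (hb : ∀ x ∈ I, |g x| ≤ M) :
    ∃ r : Literature.NumberTheory.Transcendental.KZ.IntegralRep 1,
      r.domain = {t | t 0 ∈ I} ∧ r.integrand = fun t => g (t 0) := by
  have hφint : Integrable (I.indicator fun _ => (1 : ℝ)) :=
    (integrableOn_const (hs := hIfin)).integrable_indicator hIm
  have hmeas : MeasurableSet {t : Fin 1 → ℝ | t 0 ∈ I} := IsSemialgebraic.measurableSet_holds hI
  have hint : IntegrableOn (fun t : Fin 1 → ℝ => g (t 0)) {t : Fin 1 → ℝ | t 0 ∈ I} := by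
    refine integrableOn_of_abs_le_const_mul_prod hφint hmeas
      (measurable_restrict_of_isSemialgebraicFunOn hg) M fun t ht => ?_
    have ht' : t 0 ∈ I := ht
    rw [Fin.prod_univ_one, Set.indicator_of_mem ht', mul_one]
    exact hb _ ht'
  exact ⟨⟨{t | t 0 ∈ I}, fun t => g (t 0), hI, hg, hint⟩, rfl, rfl⟩

/-- **Line representations on a bounded open interval from continuity on its closure**: a function continuous
on `[a, b]` and `ℚ`-semialgebraic on `(a, b)` gives the KZ representation `[(a,b), g]`.
[cite: KontsevichZagier2001, §1.1] -/
theorem asmReps_exists_rep1_Ioo {a b : ℝ} (g : ℝ → ℝ)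
    (hI : IsSemialgebraic ℚ {t : Fin 1 → ℝ | t 0 ∈ Set.Ioo a b})
    (hg : IsSemialgebraicFunOn ℚ {t : Fin 1 → ℝ | t 0 ∈ Set.Ioo a b} (fun t => g (t 0)))
    (hgc : ContinuousOn g (Set.Icc a b)) :
    ∃ r : Literature.NumberTheory.Transcendental.KZ.IntegralRep 1,
      r.domain = {t | a < t 0 ∧ t 0 < b} ∧ r.integrand = fun t => g (t 0) := by
  obtain ⟨M, hM⟩ := (isCompact_Icc.image_of_continuousOn hgc).isBounded.subset_closedBall_lt 0 0
  obtain ⟨r, hd, hi⟩ := asmReps_exists_rep1 (Set.Ioo a b) g M hI measurableSet_Ioo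
    (measure_Ioo_lt_top.ne) hg fun x hx => by
      have := hM.2 ⟨x, Ioo_subset_Icc_self hx, rfl⟩
      simpa [Metric.mem_closedBall, Real.dist_eq] using this
  exact ⟨r, by rw [hd]; rfl, hi⟩

end Summit.KontsevichZagierPeriods.KontsevichZagierPeriods.Cruxes.NeronTorsionSector.Translation
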